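import Mathlib.MeasureTheory.Integral.IntervalIntegral.Basic
import Mathlib.Analysis.SpecialFunctions.Log.Basic
import Mathlib.Algebra.Order.Floor.Defs
import HarnessLib

/-!
# Crux `NearExtremalTransience` (stmt-NavierStokesRegularity-21883), line `birth`: the calculus stub
# `stub_blocksToLog` — per-unit-log-block bounds sum to a log-time bound

Theorems file of route `ExtremiserTransience` (lands `--supports stmt-NavierStokesRegularity-21883`;
registered sub-goal `stub_blocksToLog` of the BC3 birth skeleton, by name and signature).

Let `t₁ < T`, `A ≥ 0`, and let `g ≥ 0` on `[t₁, T)` be interval-integrable on every `[t₁, t]`,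
`t < T`. The unit log-time blocks are `[s n, s (n+1)]` with `s n = T − (T − t₁)e^{−n}` (so `s 0 = t₁`,
`s n ↑ T`, and each block carries mass `1` for the weight `dτ/(T − τ)`). If `∫_{s n}^{s (n+1)} g ≤ A`
for every `n`, then for every `t ∈ [t₁, T)`

  `∫_{t₁}^{t} g ≤ A · log((T − t₁)/(T − t)) + A`.

Proof: with `L = log((T − t₁)/(T − t)) ≥ 0` and `N = ⌈L⌉₊` one has `t ≤ s N` (because
`e^{−N} ≤ e^{−L} = (T − t)/(T − t₁)`), so by positivity `∫_{t₁}^t g ≤ ∫_{s 0}^{s N} g = Σ_{n<N} ∫_{s n}^{s (n+1)} g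
≤ N·A ≤ (L + 1)·A`. Used by the skeleton's composition with `g = k²/(T − τ)` (the log-time quadratic mean
of a flow-wise depletion coefficient). Pure real analysis; nothing about Navier–Stokes is proved here.
[folklore]
-/

noncomputable section

-- the mandated stub namespace repeats `NavierStokesRegularity` (tree precedent for crux stubs)
set_option linter.dupNamespace false

namespace Summit.NavierStokesRegularity.NavierStokesRegularity.Theorems.NearExtremalTransience.Birth

open Set MeasureTheory

/-- **`stub_blocksToLog` (registered stub of crux stmt-NavierStokesRegularity-21883, line `birth`).**
If `g ≥ 0` on `[t₁, T)` (`t₁ < T`) is interval-integrable on every `[t₁, t]`, `t < T`, and its integral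
over each unit log-time block `[T − (T−t₁)e^{−n}, T − (T−t₁)e^{−(n+1)}]` is at most `A ≥ 0`, then
`∫_{t₁}^t g ≤ A·log((T−t₁)/(T−t)) + A` for every `t ∈ [t₁, T)` (the first `⌈log((T−t₁)/(T−t))⌉ ≤ log(…) + 1`
blocks cover `[t₁, t]`). [folklore] -/
theorem stub_blocksToLog :
    ∀ (g : ℝ → ℝ) (t₁ T A : ℝ), t₁ < T → 0 ≤ A → (∀ τ ∈ Set.Ico t₁ T, 0 ≤ g τ) → (∀ t ∈ Set.Ico t₁ T, IntervalIntegrable g MeasureTheory.volume t₁ t) → (∀ n : ℕ, ∫ τ in (T - (T - t₁) * Real.exp (-(n : ℝ)))..(T - (T - t₁) * Real.exp (-((n : ℝ) + 1))), g τ ≤ A) → ∀ t ∈ Set.Ico t₁ T, ∫ τ in t₁..t, g τ ≤ A * Real.log ((T - t₁) / (T - t)) + A := by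
  intro g t₁ T A ht₁T hA hg0 hgi hblock t ht
  -- the block endpoints `s n = T − (T − t₁)e^{−n}`
  obtain ⟨s, hs⟩ : ∃ s : ℕ → ℝ, ∀ n, s n = T - (T - t₁) * Real.exp (-(n : ℝ)) := ⟨_, fun _ => rfl⟩
  have hTt : 0 < T - t := sub_pos.2 ht.2
  have hTt₁ : 0 < T - t₁ := sub_pos.2 ht₁T
  have hs0 : s 0 = t₁ := by rw [hs]; simp
  have hsT : ∀ n, s n < T := fun n => by
    have h : 0 < (T - t₁) * Real.exp (-(n : ℝ)) := mul_pos hTt₁ (Real.exp_pos _)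
    rw [hs]; linarith
  have hs_mono : Monotone s := by
    intro m n hmn
    rw [hs, hs]
    have h : Real.exp (-(n : ℝ)) ≤ Real.exp (-(m : ℝ)) :=
      Real.exp_le_exp.2 (neg_le_neg (Nat.cast_le.2 hmn))
    nlinarith
  have ht₁s : ∀ n, t₁ ≤ s n := fun n => by rw [← hs0]; exact hs_mono (Nat.zero_le n)
  -- the number of blocks `N = ⌈L⌉₊`, `L = log((T − t₁)/(T − t))`
  set L : ℝ := Real.log ((T - t₁) / (T - t)) with hL
  have hL0 : 0 ≤ L := Real.log_nonneg ((one_le_div hTt).2 (by linarith [ht.1]))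
  set N : ℕ := ⌈L⌉₊ with hN
  have hNL : (N : ℝ) < L + 1 := Nat.ceil_lt_add_one hL0
  have hLN : L ≤ N := Nat.le_ceil L
  -- `t ≤ s N`
  have htsN : t ≤ s N := by
    have h1 : Real.exp (-(N : ℝ)) ≤ Real.exp (-L) := Real.exp_le_exp.2 (neg_le_neg hLN)
    have h2 : Real.exp (-L) = (T - t) / (T - t₁) := by
      rw [hL, Real.exp_neg, Real.exp_log (div_pos hTt₁ hTt), inv_div]
    have h3 : (T - t₁) * Real.exp (-(N : ℝ)) ≤ T - t := by
      calc (T - t₁) * Real.exp (-(N : ℝ)) ≤ (T - t₁) * ((T - t) / (T - t₁)) := by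
            rw [← h2]; exact mul_le_mul_of_nonneg_left h1 hTt₁.le
        _ = T - t := by field_simp
    rw [hs]; linarith
  -- integrability on the blocks and the telescoping sum
  have hblk_int : ∀ k < N, IntervalIntegrable g volume (s k) (s (k + 1)) := by
    intro k _
    refine (hgi (s (k + 1)) ⟨ht₁s _, hsT _⟩).mono_set ?_
    rw [Set.uIcc_of_le (ht₁s _), Set.uIcc_of_le (hs_mono (Nat.le_succ k))]
    exact Set.Icc_subset_Icc (ht₁s k) le_rfl
  have hsum : ∑ k ∈ Finset.range N, ∫ τ in s k..s (k + 1), g τ = ∫ τ in s 0..s N, g τ :=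
    intervalIntegral.sum_integral_adjacent_intervals hblk_int
  -- monotonicity in the upper endpoint (`g ≥ 0`)
  have hmono : ∫ τ in t₁..t, g τ ≤ ∫ τ in t₁..s N, g τ := by
    refine intervalIntegral.integral_mono_interval le_rfl ht.1 htsN ?_ (hgi (s N) ⟨ht₁s _, hsT _⟩)
    refine (ae_restrict_mem measurableSet_Ioc).mono fun τ hτ => ?_
    exact hg0 τ ⟨hτ.1.le, lt_of_le_of_lt hτ.2 (hsT N)⟩
  -- the per-block bounds
  have hblocks : ∑ k ∈ Finset.range N, ∫ τ in s k..s (k + 1), g τ ≤ ∑ _k ∈ Finset.range N, A := by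
    refine Finset.sum_le_sum fun k _ => ?_
    have h := hblock k
    rw [hs, hs]
    push_cast
    exact h
  calc ∫ τ in t₁..t, g τ ≤ ∫ τ in t₁..s N, g τ := hmono
    _ = ∑ k ∈ Finset.range N, ∫ τ in s k..s (k + 1), g τ := by rw [hsum, hs0]
    _ ≤ ∑ _k ∈ Finset.range N, A := hblocks
    _ = (N : ℝ) * A := by simp
    _ ≤ (L + 1) * A := mul_le_mul_of_nonneg_right hNL.le hA
    _ = A * L + A := by ring

end Summit.NavierStokesRegularity.NavierStokesRegularity.Theorems.NearExtremalTransience.Birth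

end
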